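import Summits.Ventures.HSemireg.WedgeHankelPairGrading
import Summits.Ventures.HSemireg.WedgeHankelSubstitution
import Summits.Ventures.HSemireg.WedgeHankelPairMixing

/-!
# Venture HSemireg — THE PAIR GRADING IS A STRUCTURE: pair-homogeneous spans MULTIPLY, every substitution of the letters (H1's `Sb`, singular included) PRESERVES them and
# commutes with the projections, IMAGES are pair-graded like kernels, and the pieces are the WEIGHT SPACES of H9's torus (`Pm (diagonal d) = Π_c d_c^{τ_c}` on `Sp(ptype = τ)`)

HONEST FRAMING. Part of the Lean index of the computation cell `pub-hsemireg` (seat p10 gen 19, Sunday typer «UNIFORM-IN-n»).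
Finite-dimensional EXTERIOR ALGEBRA over a field ONLY: no variety, no cohomology theory, no sheaf, no Ext group, no semiregularity map;
nothing here says that HC / HC_CM / HC_AV holds; no Literature fact is declared or used.  Custodian versions as in `WedgeHankelSiegelIdeal` (1/3); the dictionary (the pairs
`(x_a, y_a)` = `(∂_a, dz̄_a)`; the pair type of a monomial = its multidegree in the `n` factors; the torus of `GL_n` = rescaling the factors) is QUOTED, never asserted.

WHAT IS IN THE TREE.  H10 `WedgeHankelPairGrading` (this lineage, 923): `ptype t` (letters per pair), `ptype_union`, `ptype_of_Tr`, `mul_mem_Sp_ptype_succ` / `_ne`, and **every KERNEL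
of a transversal class is the direct sum of its pair-type components** (`proj_ptype_mem_Kr`, `Kr_eq_sup_inf_Sp_ptype`); its header left «images are graded as well» and «every substitution
of the letters preserves `ptype`» as NOT spelled out.  H1 `WedgeHankelSubstitution` (899): `Sb α β γ δ` (`Sb_X`, `Sb_Y`).  H9 `WedgeHankelPairMixing` (914): `Pm M` (`Pm_X`, `Pm_Y`).
w3's support calculus (`Sp`, `proj`, `mul_mem_Sp`, `proj_eq_self` / `proj_eq_zero`, `B_mul_B`, `u_ne_zero_iff`).  THIS FILE makes the grading a structure (namespace
`Summit.Ventures.HSemireg.Wedge.HankelPairGrading` continued):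
* §163 `ptype_empty` / `ptype_singleton` / `ptype_pt_singleton`; **`mul_mem_Sp_ptype_add`: `Sp(ptype = τ) · Sp(ptype = τ′) ≤ Sp(ptype = τ + τ′)`** (the grading is
  multiplicative); `mem_Sp_true` (everything is a sum of monomials).
* §164 **`map_B_mem_Sp_ptype` / `map_mem_Sp_ptype`: an algebra endomorphism `F` that keeps EVERY LETTER INSIDE ITS PAIR (`F(e_i) ∈ Sp(ptype = ptype {i})`) maps `Sp(P ∘ ptype)` into
  itself for EVERY predicate `P` on pair types** (Finset induction on the monomial via `B_{a} ∧ B_s = u·B_{a ∪ s}`, then span induction), and **`proj_map_comm`**: it COMMUTES with every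
  projection `proj_{P ∘ ptype}`.  Instances: **`Sb_mem_Sp_ptype` / `proj_Sb_comm`** for H1's substitution `Sb α β γ δ` with ANY `α β γ δ` (so for `Φs`, `Ψs`, `Δs`, `Ls`, `Xsc` and all
  words), and **`Pm_diagonal_mem_Sp_ptype`** for H9's torus `Pm (diagonal d)`.
* §165 IMAGES ARE PAIR-GRADED: **`proj_ptype_succ_mul`: `proj_{ptype = τ+1}(θ ∧ f) = proj_{ptype = τ}(θ) ∧ f`** for a transversal `f`; `mul_mem_Sp_ptype_pos` (`θ ∧ f` has `≥ 1` letter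
  in every pair), `proj_ptype_mul_eq_zero_of_exists_zero`; hence **`proj_ptype_mem_V`: `v ∈ V(univ, f, k) ⇒ proj_{ptype = σ} v ∈ V(univ, f, k)`** for every `σ`, in particular
  **`proj_ptype_mem_V_w`** for th-7's classes — the image side of H10.
* §166 THE PIECES ARE TORUS WEIGHT SPACES: `Pm_diagonal_gx`, **`Pm_diagonal_B`: `Pm (diagonal d) E_s = (Π_{i ∈ s} d_{pr i})·E_s`**, `prod_pr_eq_prod_pow`, and
  **`Pm_diagonal_of_mem_Sp_ptype`: `Pm (diagonal d) θ = (Π_c d_c^{τ_c})·θ` for `θ ∈ Sp(ptype = τ)`** — H9b's `GL_n`-stability restricted to the torus IS H10's grading, with the character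
  `d ↦ Π_c d_c^{τ_c}` on the `τ`-component (`Pm_diagonal_proj_ptype`); over a field too small to separate the characters only H10's field-free form survives.
NOT typed here: the converse «weight spaces = pair-type components» (needs enough units in `K` to separate the characters `Π_c d_c^{τ_c}`, `τ ≤ 2`); the finer `ℕⁿ × ℕⁿ`-grading
by `x`/`y`-letters (preserved by `Δs`/`Xsc` but not by `Φs`); anything Ext-side.  Class side only; new names only.
-/

open Module

namespace Summit.Ventures.HSemireg.Wedge.HankelPairGrading

open Summit.Ventures.HSemireg.Wedge Summit.Ventures.HSemireg.Wedge.Kunneth Summit.Ventures.HSemireg.Wedge.Hankel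
  Summit.Ventures.HSemireg.Wedge.KunnethKernel Summit.Ventures.HSemireg.Wedge.Weil Summit.Ventures.HSemireg.Wedge.HankelFrameChange
  Summit.Ventures.HSemireg.Wedge.HankelPairMixing

variable (K : Type*) [Field K] {N : ℕ}

/-! ## §163. Pair-homogeneous spans multiply -/

omit [Field K] in
/-- the empty support has pair type `0`. -/
lemma ptype_empty : ptype (∅ : Finset (In N)) = 0 := by
  funext c; simp [ptype]

omit [Field K] in
/-- a single letter `i` has pair type `δ_{pr i}`. -/
lemma ptype_singleton (i : In N) : ptype ({i} : Finset (In N)) = fun c => if pr i = c then 1 else 0 := by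
  funext c
  simp only [ptype, Finset.filter_singleton]
  split_ifs with h
  · rw [Finset.card_singleton]
  · rw [Finset.card_empty]

omit [Field K] in
/-- the partner letter has the same pair type. -/
lemma ptype_pt_singleton (i : In N) : ptype ({pt i} : Finset (In N)) = ptype ({i} : Finset (In N)) := by
  rw [ptype_singleton, ptype_singleton, pr_pt]

/-- **THE PAIR GRADING IS MULTIPLICATIVE: `Sp(ptype = τ) · Sp(ptype = τ′) ≤ Sp(ptype = τ + τ′)`** (w3's `mul_mem_Sp` + H10's `ptype_union`). -/
theorem mul_mem_Sp_ptype_add {τ τ' : Fin N → ℕ} {θ η : HT K (In N)} (hθ : θ ∈ Sp K (fun s : Finset (In N) => ptype s = τ))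
    (hη : η ∈ Sp K (fun s : Finset (In N) => ptype s = τ')) : θ * η ∈ Sp K (fun s : Finset (In N) => ptype s = τ + τ') :=
  mul_mem_Sp (fun s t hd hs ht => by rw [ptype_union hd, hs, ht]) hθ hη

/-- every form is a sum of monomials: `θ ∈ Sp(True)`. -/
lemma mem_Sp_true (θ : HT K (In N)) : θ ∈ Sp K (fun _ : Finset (In N) => True) := by
  have e : (fun s : Finset (In N) => B K (In N) s) '' {s | True} = Set.range (B K (In N)) := by
    ext x; simp
  rw [Sp, e, (B K (In N)).span_eq]
  exact Submodule.mem_top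

/-- a monomial is pair-homogeneous of its own pair type. -/
lemma B_mem_Sp_ptype (s : Finset (In N)) : B K (In N) s ∈ Sp K (fun t : Finset (In N) => ptype t = ptype s) := B_mem_Sp rfl

/-- inserting a fresh letter: `E_{insert a s} = u({a}, s)⁻¹ · (e_a ∧ E_s)` (`u ≠ 0` for disjoint supports). -/
lemma B_insert_eq_smul (a : In N) {s : Finset (In N)} (ha : a ∉ s) :
    B K (In N) (insert a s) = (u K ({a} : Finset (In N)) s)⁻¹ • (gx K a * B K (In N) s) := by
  have hd : Disjoint ({a} : Finset (In N)) s := Finset.disjoint_singleton_left.mpr ha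
  have hu : u K ({a} : Finset (In N)) s ≠ 0 := (u_ne_zero_iff K).mpr hd
  rw [show gx K a = B K (In N) {a} from rfl, B_mul_B, smul_smul, inv_mul_cancel₀ hu, one_smul, Finset.insert_eq]

/-! ## §164. Letter-local algebra maps preserve the pair grading and commute with its projections -/

/-- **AN ALGEBRA ENDOMORPHISM THAT KEEPS EVERY LETTER INSIDE ITS PAIR maps each monomial into the span of its own pair type.** -/
theorem map_B_mem_Sp_ptype (F : HT K (In N) →ₐ[K] HT K (In N)) (hF : ∀ i : In N, F (gx K i) ∈ Sp K (fun t : Finset (In N) => ptype t = ptype ({i} : Finset (In N))))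
    (s : Finset (In N)) : F (B K (In N) s) ∈ Sp K (fun t : Finset (In N) => ptype t = ptype s) := by
  classical
  induction s using Finset.induction_on with
  | empty => rw [B_empty, map_one, ← B_empty K]; exact B_mem_Sp_ptype K ∅
  | insert a s ha ih =>
    have hd : Disjoint ({a} : Finset (In N)) s := Finset.disjoint_singleton_left.mpr ha
    rw [B_insert_eq_smul K a ha, map_smul, map_mul]
    refine Submodule.smul_mem _ _ ?_
    have h := mul_mem_Sp_ptype_add K (hF a) ih
    rwa [← ptype_union hd, ← Finset.insert_eq] at h

/-- **… hence it maps `Sp(P ∘ ptype)` into itself for EVERY predicate `P` on pair types.** -/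
theorem map_mem_Sp_ptype (F : HT K (In N) →ₐ[K] HT K (In N)) (hF : ∀ i : In N, F (gx K i) ∈ Sp K (fun t : Finset (In N) => ptype t = ptype ({i} : Finset (In N))))
    (P : (Fin N → ℕ) → Prop) {θ : HT K (In N)} (hθ : θ ∈ Sp K (fun s : Finset (In N) => P (ptype s))) : F θ ∈ Sp K (fun s : Finset (In N) => P (ptype s)) := by
  induction hθ using Submodule.span_induction with
  | mem x hx =>
    obtain ⟨s, hs, rfl⟩ := hx
    exact Sp_mono (fun t (ht : ptype t = ptype s) => by rw [ht]; exact hs) (map_B_mem_Sp_ptype K F hF s)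
  | zero => rw [map_zero]; exact Submodule.zero_mem _
  | add x y _ _ hx hy => rw [map_add]; exact Submodule.add_mem _ hx hy
  | smul c x _ hx => rw [map_smul]; exact Submodule.smul_mem _ _ hx

/-- **… and it COMMUTES WITH EVERY PAIR-TYPE PROJECTION: `proj_{P∘ptype}(F θ) = F(proj_{P∘ptype} θ)`.** -/
theorem proj_map_comm (F : HT K (In N) →ₐ[K] HT K (In N)) (hF : ∀ i : In N, F (gx K i) ∈ Sp K (fun t : Finset (In N) => ptype t = ptype ({i} : Finset (In N))))
    (P : (Fin N → ℕ) → Prop) [DecidablePred fun s : Finset (In N) => P (ptype s)] (θ : HT K (In N)) :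
    proj (K := K) (fun s : Finset (In N) => P (ptype s)) (F θ) = F (proj (K := K) (fun s : Finset (In N) => P (ptype s)) θ) := by
  classical
  conv_lhs => rw [← proj_add_proj_not (K := K) (fun s : Finset (In N) => P (ptype s)) θ]
  rw [map_add, map_add, proj_eq_self (fun s h => h) (map_mem_Sp_ptype K F hF P (proj_mem _ θ)),
    proj_eq_zero (Q := fun s : Finset (In N) => ¬ P (ptype s)) (fun s h => h) (map_mem_Sp_ptype K F hF (fun τ => ¬ P τ) (proj_mem _ θ)), add_zero]

/-- `x_c = e_{xJ c}` and `y_c = e_{yJ c}` as monomials. -/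
lemma X_eq_gx_xJ (c : Fin N) : X K N c = gx K (xJ N c) := by
  rw [X_fin, gx_eq_ι]; rfl

/-- `y_c = e_{yJ c}`. -/
lemma Y_eq_gx_yJ (c : Fin N) : Y K N c = gx K (yJ N c) := by
  rw [Y_fin, gx_eq_ι]; rfl

/-- the two letters of pair `c` are pair-homogeneous of type `δ_c`. -/
lemma X_mem_Sp_ptype (c : Fin N) : X K N c ∈ Sp K (fun t : Finset (In N) => ptype t = ptype ({xJ N c} : Finset (In N))) := by
  rw [X_eq_gx_xJ]; exact B_mem_Sp_ptype K {xJ N c}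

/-- `y_c ∈ Sp(ptype = δ_c)` (same type as `x_c`). -/
lemma Y_mem_Sp_ptype (c : Fin N) : Y K N c ∈ Sp K (fun t : Finset (In N) => ptype t = ptype ({xJ N c} : Finset (In N))) := by
  rw [Y_eq_gx_yJ, ← pt_xJ, ← ptype_pt_singleton]; exact B_mem_Sp_ptype K {pt (xJ N c)}

/-- **H1's SUBSTITUTION KEEPS EVERY LETTER IN ITS PAIR**: `Sb α β γ δ (e_i) ∈ Sp(ptype = ptype {i})` for EVERY `α β γ δ`. -/
theorem Sb_gx_mem_Sp_ptype (α β γ δ : K) (i : In N) : Sb K α β γ δ (gx K i) ∈ Sp K (fun t : Finset (In N) => ptype t = ptype ({i} : Finset (In N))) := by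
  rcases eq_xJ_or_eq_yJ i with e | e
  · rw [e, ← X_eq_gx_xJ, Sb_X]
    exact Submodule.add_mem _ (Submodule.smul_mem _ _ (X_mem_Sp_ptype K _)) (Submodule.smul_mem _ _ (Y_mem_Sp_ptype K _))
  · rw [e, ← Y_eq_gx_yJ, Sb_Y, ← pt_xJ, ptype_pt_singleton]
    exact Submodule.add_mem _ (Submodule.smul_mem _ _ (X_mem_Sp_ptype K _)) (Submodule.smul_mem _ _ (Y_mem_Sp_ptype K _))

/-- **EVERY SUBSTITUTION OF THE LETTERS PRESERVES THE PAIR GRADING: `θ ∈ Sp(P ∘ ptype) ⇒ Sb α β γ δ θ ∈ Sp(P ∘ ptype)`** (any `α β γ δ`, singular included; so do `Φs`, `Ψs`, `Δs`, `Ls`,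
`Xsc` and all words in them). -/
theorem Sb_mem_Sp_ptype (α β γ δ : K) (P : (Fin N → ℕ) → Prop) {θ : HT K (In N)} (hθ : θ ∈ Sp K (fun s : Finset (In N) => P (ptype s))) :
    Sb K α β γ δ θ ∈ Sp K (fun s : Finset (In N) => P (ptype s)) :=
  map_mem_Sp_ptype K (Sb K α β γ δ) (Sb_gx_mem_Sp_ptype K α β γ δ) P hθ

/-- **… and commutes with the pair-type projections.** -/
theorem proj_Sb_comm (α β γ δ : K) (P : (Fin N → ℕ) → Prop) [DecidablePred fun s : Finset (In N) => P (ptype s)] (θ : HT K (In N)) :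
    proj (K := K) (fun s : Finset (In N) => P (ptype s)) (Sb K α β γ δ θ) = Sb K α β γ δ (proj (K := K) (fun s : Finset (In N) => P (ptype s)) θ) :=
  proj_map_comm K (Sb K α β γ δ) (Sb_gx_mem_Sp_ptype K α β γ δ) P θ

/-! ## §165. Images are pair-graded -/

/-- **`proj_{ptype = τ+1}(θ ∧ f) = proj_{ptype = τ}(θ) ∧ f` for a TRANSVERSAL `f`** — the component of type `τ` goes to type `τ + 1`, the rest has no such component (H10). -/
theorem proj_ptype_succ_mul (τ : Fin N → ℕ) (θ : HT K (In N)) {f : HT K (In N)} (hf : f ∈ Sp K (Tr (N := N))) :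
    proj (K := K) (fun s : Finset (In N) => ptype s = τ + 1) (θ * f) = proj (K := K) (fun s : Finset (In N) => ptype s = τ) θ * f := by
  classical
  conv_lhs => rw [← proj_add_proj_not (K := K) (fun s : Finset (In N) => ptype s = τ) θ]
  rw [add_mul, map_add, proj_eq_self (fun s h => h) (mul_mem_Sp_ptype_succ K (proj_mem _ θ) hf),
    proj_eq_zero (Q := fun s : Finset (In N) => ¬ ptype s = τ + 1) (fun s h => h) (mul_mem_Sp_ptype_ne K (proj_mem _ θ) hf), add_zero]

/-- a multiple of a transversal class has at least one letter in every pair. -/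
theorem mul_mem_Sp_ptype_pos (θ : HT K (In N)) {f : HT K (In N)} (hf : f ∈ Sp K (Tr (N := N))) :
    θ * f ∈ Sp K (fun u : Finset (In N) => ∀ c, 1 ≤ ptype u c) :=
  mul_mem_Sp (P := fun _ => True) (fun s t hd _ ht c => by rw [ptype_union hd, ptype_of_Tr ht, Pi.add_apply]; exact Nat.le_add_left 1 _) (mem_Sp_true K θ) hf

/-- … so its components of a pair type with an EMPTY pair vanish. -/
theorem proj_ptype_mul_eq_zero_of_exists_zero {σ : Fin N → ℕ} (hσ : ∃ c, σ c = 0) (θ : HT K (In N)) {f : HT K (In N)} (hf : f ∈ Sp K (Tr (N := N))) :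
    proj (K := K) (fun s : Finset (In N) => ptype s = σ) (θ * f) = 0 := by
  classical
  refine proj_eq_zero (Q := fun u : Finset (In N) => ∀ c, 1 ≤ ptype u c) (fun s hs hσ' => ?_) (mul_mem_Sp_ptype_pos K θ hf)
  obtain ⟨c, hc⟩ := hσ
  have h := hs c
  rw [hσ', hc] at h
  exact Nat.not_succ_le_zero 0 h

/-- **IMAGES ARE PAIR-GRADED: `v ∈ V(univ, f, k) ⇒ proj_{ptype = σ} v ∈ V(univ, f, k)` for every pair type `σ`** (`f` transversal) — the image side of H10's `proj_ptype_mem_Kr`. -/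
theorem proj_ptype_mem_V (σ : Fin N → ℕ) {f : HT K (In N)} (hf : f ∈ Sp K (Tr (N := N))) {k : ℕ} {v : HT K (In N)} (hv : v ∈ V K (In N) Finset.univ f k) :
    proj (K := K) (fun s : Finset (In N) => ptype s = σ) v ∈ V K (In N) Finset.univ f k := by
  classical
  rw [V_eq_map] at hv ⊢
  obtain ⟨θ, hθ, rfl⟩ := hv
  by_cases h : ∃ c, σ c = 0
  · rw [LinearMap.mulRight_apply, proj_ptype_mul_eq_zero_of_exists_zero K h θ hf]
    exact Submodule.zero_mem _
  · have h' : ∀ c, 1 ≤ σ c := fun c => Nat.one_le_iff_ne_zero.mpr fun hc => h ⟨c, hc⟩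
    have e : σ = (fun c => σ c - 1) + 1 := funext fun c => by have := h' c; simp only [Pi.add_apply, Pi.one_apply]; omega
    rw [e, LinearMap.mulRight_apply, proj_ptype_succ_mul K _ θ hf]
    exact Submodule.mem_map_of_mem (proj_mem_Hom K _ hθ)

/-- **… in particular for th-7's classes: `v ∈ V(univ, w_N(q), k) ⇒ proj_{ptype = σ} v ∈ V(univ, w_N(q), k)`.** -/
theorem proj_ptype_mem_V_w (σ : Fin N → ℕ) (q : ℕ → K) {k : ℕ} {v : HT K (In N)} (hv : v ∈ V K (In N) Finset.univ (w K N N q) k) :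
    proj (K := K) (fun s : Finset (In N) => ptype s = σ) v ∈ V K (In N) Finset.univ (w K N N q) k :=
  proj_ptype_mem_V K σ (w_mem_Sp_Tr K q) hv

/-- the image splits along `ptype = σ` / `ptype ≠ σ` as well. -/
theorem proj_not_ptype_mem_V (σ : Fin N → ℕ) {f : HT K (In N)} (hf : f ∈ Sp K (Tr (N := N))) {k : ℕ} {v : HT K (In N)} (hv : v ∈ V K (In N) Finset.univ f k) :
    proj (K := K) (fun s : Finset (In N) => ¬ ptype s = σ) v ∈ V K (In N) Finset.univ f k := by
  classical
  have e : proj (K := K) (fun s : Finset (In N) => ¬ ptype s = σ) v = v - proj (K := K) (fun s : Finset (In N) => ptype s = σ) v :=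
    eq_sub_of_add_eq' (proj_add_proj_not (K := K) (fun s : Finset (In N) => ptype s = σ) v)
  rw [e]
  exact Submodule.sub_mem _ hv (proj_ptype_mem_V K σ hf hv)

/-- **THE IMAGE IS THE DIRECT SUM OF ITS PAIR-TYPE PIECE AND THE REST** (cf. H10 `Kr_eq_sup_inf_Sp_ptype`; the two pieces meet in `0` by H10 `inf_Sp_ptype_disjoint`). -/
theorem V_eq_sup_inf_Sp_ptype (σ : Fin N → ℕ) {f : HT K (In N)} (hf : f ∈ Sp K (Tr (N := N))) (k : ℕ) :
    V K (In N) Finset.univ f k = V K (In N) Finset.univ f k ⊓ Sp K (fun s : Finset (In N) => ptype s = σ) ⊔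
      V K (In N) Finset.univ f k ⊓ Sp K (fun s : Finset (In N) => ¬ ptype s = σ) := by
  classical
  refine le_antisymm (fun v hv => ?_) (sup_le inf_le_left inf_le_left)
  rw [← proj_add_proj_not (K := K) (fun s : Finset (In N) => ptype s = σ) v]
  exact Submodule.add_mem_sup ⟨proj_ptype_mem_V K σ hf hv, proj_mem _ v⟩ ⟨proj_not_ptype_mem_V K σ hf hv, proj_mem _ v⟩

/-! ## §166. The pieces are the weight spaces of the torus -/

/-- **the torus on a letter: `Pm (diagonal d) e_i = d_{pr i} · e_i`.** -/
theorem Pm_diagonal_gx (d : Fin N → K) (i : In N) : Pm K (Matrix.diagonal d) (gx K i) = d (pr i) • gx K i := by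
  rcases eq_xJ_or_eq_yJ i with e | e
  · rw [e, ← X_eq_gx_xJ, Pm_X, Finset.sum_eq_single (pr i), Matrix.diagonal_apply_eq, pr_xJ]
    · intro c _ hc; rw [Matrix.diagonal_apply_ne _ hc, zero_smul]
    · intro h; exact absurd (Finset.mem_univ _) h
  · rw [e, ← Y_eq_gx_yJ, Pm_Y, Finset.sum_eq_single (pr i), Matrix.diagonal_apply_eq, pr_yJ]
    · intro c _ hc; rw [Matrix.diagonal_apply_ne _ hc, zero_smul]
    · intro h; exact absurd (Finset.mem_univ _) h

/-- the torus keeps letters in their pairs. -/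
lemma Pm_diagonal_gx_mem_Sp_ptype (d : Fin N → K) (i : In N) :
    Pm K (Matrix.diagonal d) (gx K i) ∈ Sp K (fun t : Finset (In N) => ptype t = ptype ({i} : Finset (In N))) := by
  rw [Pm_diagonal_gx]
  exact Submodule.smul_mem _ _ (B_mem_Sp_ptype K {i})

/-- **the torus preserves the pair grading** (the field-free shadow of H9b). -/
theorem Pm_diagonal_mem_Sp_ptype (d : Fin N → K) (P : (Fin N → ℕ) → Prop) {θ : HT K (In N)} (hθ : θ ∈ Sp K (fun s : Finset (In N) => P (ptype s))) :
    Pm K (Matrix.diagonal d) θ ∈ Sp K (fun s : Finset (In N) => P (ptype s)) :=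
  map_mem_Sp_ptype K (Pm K (Matrix.diagonal d)) (Pm_diagonal_gx_mem_Sp_ptype K d) P hθ

/-- **the torus on a monomial: `Pm (diagonal d) E_s = (Π_{i ∈ s} d_{pr i}) · E_s`.** -/
theorem Pm_diagonal_B (d : Fin N → K) (s : Finset (In N)) : Pm K (Matrix.diagonal d) (B K (In N) s) = (∏ i ∈ s, d (pr i)) • B K (In N) s := by
  classical
  induction s using Finset.induction_on with
  | empty => rw [B_empty, map_one, Finset.prod_empty, one_smul]
  | insert a s ha ih =>
    rw [B_insert_eq_smul K a ha, map_smul, map_mul, Pm_diagonal_gx, ih, Finset.prod_insert ha, smul_mul_smul_comm, smul_comm]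

omit [Field K] in
/-- the weight of a support: `Π_{i ∈ s} d_{pr i} = Π_c d_c^{ptype s c}`. -/
lemma prod_pr_eq_prod_pow {M : Type*} [CommMonoid M] (d : Fin N → M) (s : Finset (In N)) : ∏ i ∈ s, d (pr i) = ∏ c, d c ^ ptype s c := by
  rw [← Finset.prod_fiberwise_of_maps_to' (t := Finset.univ) (g := pr) (fun i _ => Finset.mem_univ (pr i)) d]
  exact Finset.prod_congr rfl fun c _ => by rw [Finset.prod_const]; rfl

/-- **THE PAIR-TYPE COMPONENTS ARE THE WEIGHT SPACES OF THE TORUS: `Pm (diagonal d) θ = (Π_c d_c^{τ_c}) · θ` for `θ ∈ Sp(ptype = τ)`** (every `d`, every field). -/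
theorem Pm_diagonal_of_mem_Sp_ptype (d : Fin N → K) {τ : Fin N → ℕ} {θ : HT K (In N)} (hθ : θ ∈ Sp K (fun s : Finset (In N) => ptype s = τ)) :
    Pm K (Matrix.diagonal d) θ = (∏ c, d c ^ τ c) • θ := by
  induction hθ using Submodule.span_induction with
  | mem x hx =>
    obtain ⟨s, hs, rfl⟩ := hx
    have hs' : ptype s = τ := hs
    rw [Pm_diagonal_B, prod_pr_eq_prod_pow, hs']
  | zero => rw [map_zero, smul_zero]
  | add x y _ _ hx hy => rw [map_add, hx, hy, smul_add]
  | smul c x _ hx => rw [map_smul, hx, smul_comm]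

/-- **the torus acts on the `τ`-component of ANY form by the character `Π_c d_c^{τ_c}`: `Pm (diagonal d) (proj_{ptype = τ} θ) = (Π_c d_c^{τ_c}) · proj_{ptype = τ} θ`.** -/
theorem Pm_diagonal_proj_ptype (d : Fin N → K) (τ : Fin N → ℕ) (θ : HT K (In N)) :
    Pm K (Matrix.diagonal d) (proj (K := K) (fun s : Finset (In N) => ptype s = τ) θ) = (∏ c, d c ^ τ c) • proj (K := K) (fun s : Finset (In N) => ptype s = τ) θ := by
  classical
  exact Pm_diagonal_of_mem_Sp_ptype K d (proj_mem _ θ)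

/-- consistency with H10: a pair-type component of a kernel element of th-7's class is again a kernel element AND a torus eigenvector — `Kr(univ, w_N(q), k) ⊓ Sp(ptype = τ)` is a
weight space of H9b's torus action inside the kernel. -/
theorem Pm_diagonal_of_mem_Kr_inf_Sp_ptype (d : Fin N → K) {τ : Fin N → ℕ} (q : ℕ → K) {k : ℕ} {θ : HT K (In N)}
    (hθ : θ ∈ Kr K Finset.univ (w K N N q) k ⊓ Sp K (fun s : Finset (In N) => ptype s = τ)) :
    Pm K (Matrix.diagonal d) θ = (∏ c, d c ^ τ c) • θ ∧ Pm K (Matrix.diagonal d) θ ∈ Kr K Finset.univ (w K N N q) k :=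
  ⟨Pm_diagonal_of_mem_Sp_ptype K d hθ.2, by rw [Pm_diagonal_of_mem_Sp_ptype K d hθ.2]; exact Submodule.smul_mem _ _ hθ.1⟩

end Summit.Ventures.HSemireg.Wedge.HankelPairGrading
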